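import Summits.BirchSwinnertonDyer.Rank1Residual.Additive.GoodModelGreenbergKummerIdentification
import Summits.BirchSwinnertonDyer.Rank1Residual.Additive.KummerDeuringModelGlobal
import Summits.BirchSwinnertonDyer.Rank1Residual.Additive.GordRamifiedOrdinaryLineHigher
import Summits.BirchSwinnertonDyer.Rank1Residual.Additive.GordGreenbergKummerIdentification
import Summits.BirchSwinnertonDyer.Rank1Residual.GaloisImage.PrimeToPFixingLevel
import HarnessLib

/-!
# THE R-D IDENTIFICATION `RamifiedLineKummerEqAt` ON THE (G-ord) ROWS WITH e ∈ {3, 4, 6} — and on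
# ALL of X4♯(G-ord)/X3♯(G-ord) at every odd `p` — MOD cc-typer-2's S2 ONLY: END file of row
# T-RD-E346 (file K5; cell `b2b-bsdres`, team n1011; seat n1011-p05 gen 6)

HONEST FRAMING (cell `b2b-bsdres`, run/shared/lean/b2b/bsd-rank1-residual/, verbatim in every
file): the goal of the cell is to DELETE the COMBINATION-SHAPED residual classes of the
Birch–Swinnerton-Dyer formula for ALL analytic-rank `≤ 1` elliptic curves over `ℚ` — "full BSD
formula for every rank `≤ 1` curve in class `C`" assembled STRICTLY from published theorems — so
that the rank-`≤ 1` remainder becomes exactly the CONSTRUCTION-SHAPED classes, which are TYPED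
(missing-input `Prop`s), NOT attempted. This is not "finishing BSD". Team n1011 (X4 ∧ `p = 3`,
§I N10/N11; Route G δ-input): research route on the CONSTRUCTION-SHAPED classes X3♯(G-ord) /
X4♯(G-ord); assembly theorems CONDITIONAL on exactly ONE published named fact taken as a
hypothesis — cc-typer-2's typed S2 `Greenberg1999.imKummer_ge_strictCondition_goodOrdinaryModel`
(Greenberg LNM 1716 Prop. 2.4 for a good model; p285955), never dropped; no definition, no named
fact by this seat; nothing booked; the classes stay CONSTRUCTION-SHAPED; no label changes.

## What

cc-typer-2's typed δ-input of Route G's GV congruence transfer, `Additive.RamifiedLineKummerEqAt W p`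
("`∀ κ` cyclotomic, `∀ v ∋ p`, `∀ L` ramified ordinary: `L.greenbergKer (ker κ) = W.localKerOver p (ker κ) ℚ_v`",
`CongruentLambdaShiftOfGVTorsionIso`), was a theorem mod A239 on the defect-2 rows only (p05 rows
T-RD-Δ-K F1–F8: `ClassX4Gord/ClassX3Gord.ramifiedLineKummerEqAt (hGrK) (hX) (he : e = 2)`, through
the ℚ-model of the `p*`-twist). This file removes the defect binder:

* `ramifiedLineKummerEqAt_of_typeGOrd_of_semistabilityIndex_ne_two (hS2) (hp5) (hG : TypeGOrd W p)
  (hadd : Addv W p) (he : e ≠ 2)` — the defects `e ∈ {3, 4, 6}` at `p ≥ 5`, one proof: p07's Kummer–Deuring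
  good model with a GLOBAL Kummer generator `θ ∈ ℚ̄`, `θ^e = p` (T-ROL-EXP A3
  `exists_kummerGoodModel_global`, p290142: `C = ⟨ι(θ)^m, 0, 0, 0⟩ · C_short`, fixed by every local
  `σ` fixing `ι θ`); the prime-to-`p` NORMAL fixing level `U = core(Gal(ℚ̄/ℚ(θ)))` of K1
  (`[Γ_ℚ : U] ∣ e!`, `e ∣ p − 1 < p`); the ordinary point from `j̃ ∈ {0, 1728}` (F-B/F-C1, as in
  F-C2). At `e = 2` the residue of `j` is unconstrained, so that case is routed to F8 instead (below):
  this theorem carries `he : e ≠ 2`.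
* `ClassX4Gord.ramifiedLineKummerEqAt_of_five_le (hS2) (hX) (hp5)`,
  `ClassX3Gord.ramifiedLineKummerEqAt_of_five_le (hS2) (hX) (hp5)` — NO defect binder: `e = 2` ↦ F8
  with A239 := `imKummer_ge_strictCondition_goodOrdinary_of_goodOrdinaryModel hS2` (A239 is DERIVED
  from S2, cc-typer-2 p285955), `e ≠ 2` ↦ the theorem above.
* `ClassX4Gord.ramifiedLineKummerEqAt' (hS2) (hX)` / `ClassX3Gord.ramifiedLineKummerEqAt' (hS2) (hp2) (hX)`
  — EVERY ODD `p` (at `p = 3`, (G) forces `e = 2`: additive-p2's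
  `semistabilityIndex_eq_two_of_typeG_three`): THE δ-INPUT ON ALL OF X4♯(G-ord) / X3♯(G-ord) MOD S2.

Consumers: cc-typer-2's `ClassX4Gord/ClassX3Gord.{congruentLambdaShift,mu_eq_zero}_of_gv_…`
wrappers and p12's T-GV29-MF twins take these in place of their `hRD` binders on the `Gord_e346`
rows (N10 `CellGordHigher` 4 073 cells, O7-ord 422 cells).

References: R. Greenberg, LNM 1716 (1999) §2 Props. 2.2, 2.4 (pp. 73–75), §5 p. 143
[GreenbergLNM1716]; R. Greenberg, V. Vatsal, Invent. Math. 142 (2000) §2 pp. 16, 26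
[GreenbergVatsal2000]; J. Coates, LNM 1716 (1999) p. 31 (62) [CoatesLNM1716]; J.-P. Serre,
J. Tate, Ann. of Math. 88 (1968) §2 [SerreTate1968]; J. H. Silverman, *AEC* VII.5.5
[SilvermanAEC2009]; skeleton `cells/n1011/skel/T-RD-E346.md` (f88cc66b311ca16d).
-/

noncomputable section

open scoped Classical NNReal NumberField Polynomial

open WeierstrassCurve

universe u

namespace Summit.BirchSwinnertonDyer.Rank1Residual.Additive.GoodModelLine

open NumberField IsDedekindDomain Field IsDedekindDomain.HeightOneSpectrum
  Literature.NumberTheory.GaloisRepresentations Literature.NumberTheory.EllipticCurves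
  Literature.NumberTheory.EllipticCurves.GreenbergSelmer
  Literature.NumberTheory.EllipticCurves.Greenberg1999
  Literature.NumberTheory.EllipticCurves.EmertonPollackWeston2006
  Literature.NumberTheory.EllipticCurves.Rank1Residual
  Literature.NumberTheory.EllipticCurves.Rank1Residual.Typed
  Summit.BirchSwinnertonDyer.Rank1Residual.X2.GreenbergVatsalReductionDatum
  Summit.BirchSwinnertonDyer.Rank1Residual.GaloisImage

variable (W : WeierstrassCurve ℚ) [W.IsElliptic] [W.IsGloballyMinimal] (p : ℕ) [hp : Fact p.Prime]

/-! ## §1 The (G-ord) rows with `e ∈ {3, 4, 6}` at `p ≥ 5` -/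

/-- **THE R-D IDENTIFICATION ON THE (G-ord) ROWS WITH `e ∈ {3, 4, 6}`** (`p ≥ 5`), mod S2: for
`E/ℚ` globally minimal, ADDITIVE at `p`, of Delbourgo type (G) with ordinary reduction, semistability
defect `e_E(p) ≠ 2`: `RamifiedLineKummerEqAt W p` — for every cyclotomic `κ`, every `v ∋ p` and
every ramified ordinary line `L`, Greenberg's condition and the Kummer condition over `ℚ_∞` cut out
the same subgroup of `H¹(ℚ_∞, E[p^∞])`. Construction at `v`: p07's Kummer–Deuring good model with a
GLOBAL generator `θ`, `θ^e = p` (`exists_kummerGoodModel_global`); the ordinary point from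
`j̃ = 0 ∧ 3 ∣ p − 1` (`3 ∣ e`) or `j̃ = 1728 ∧ 4 ∣ p − 1` (`e = 4`) (F-B, F-C1); the normal core
`U` of `Gal(ℚ̄/ℚ(θ))`, open of index dividing `e!`, prime to `p` since `e ∣ p − 1` (K1), whose local
elements fix `ι θ` hence `C`; then K4 `ramifiedLineKummerEqAt_of_forall_exists_goodModel`.
[cite: GreenbergLNM1716, §2 Props. 2.2, 2.4 (pp. 73–75) and §5 p. 143]
[cite: GreenbergVatsal2000, §2 p. 16 (L_v) and p. 26] [cite: SilvermanAEC2009, Prop. VII.5.5] -/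
theorem ramifiedLineKummerEqAt_of_typeGOrd_of_semistabilityIndex_ne_two
    (hS2 : imKummer_ge_strictCondition_goodOrdinaryModel) (hp5 : 5 ≤ p) (hG : TypeGOrd W p)
    (hadd : Addv W p) (he : semistabilityIndex W p ≠ 2) : RamifiedLineKummerEqAt W p := by
  refine ramifiedLineKummerEqAt_of_forall_exists_goodModel W p hS2 hp5 fun v hpv ↦ ?_
  have hp3 : p ≠ 3 := by omega
  -- data from (G)
  have hj : 0 ≤ padicValRat p W.j := padicValRat_j_nonneg_of_typeGOrd W p hG
  have hedvd : semistabilityIndex W p ∣ p - 1 :=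
    ((typeG_iff_not_subM_and_semistabilityIndex_dvd W p hp5).mp hG.typeG).2
  have he12 := semistabilityIndex_dvd_twelve W p
  have he1 := semistabilityIndex_ne_one_of_addv W p hp5 hadd hj
  have hecase : semistabilityIndex W p = 3 ∨ semistabilityIndex W p = 4 ∨ semistabilityIndex W p = 6 ∨
      semistabilityIndex W p = 12 := by
    have hle : semistabilityIndex W p ≤ 12 := Nat.le_of_dvd (by norm_num) he12
    interval_cases h : semistabilityIndex W p <;> omega
  have helt : semistabilityIndex W p < p := by
    have h := Nat.le_of_dvd (by omega) hedvd
    omega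
  have hbad : ¬ W.HasGoodReductionAt v := by
    rw [eq_primesEquiv_symm p hpv]
    exact (hasAdditiveReductionAt_of_addv W p hadd).not_hasGoodReductionAt
  haveI := charP_residueField_specVal p hpv
  -- p07's Kummer–Deuring model with a global generator
  obtain ⟨θ, C, W₀, hθ, hW₀, hΔ, -, hfixC, -⟩ := exists_kummerGoodModel_global p W hp5 hpv hj
  -- the ordinary point (as in F-C2)
  have hord : ∃ P : (W₀.baseChange (AlgebraicClosure (v.adicCompletion ℚ))).toAffine.Point,
      (p : ℤ) • P = 0 ∧ goodReductionHom W₀ (Valuation.integer.integers (specVal v)) hΔ P ≠ 0 := by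
    by_cases h3e : 3 ∣ semistabilityIndex W p
    · have h3v : ¬ 3 ∣ padicValInt p W.minimalDiscriminantInt := by
        intro h
        have : 3 ∣ 4 := dvd_trans h3e (semistabilityIndex_dvd_four_of_three_dvd W p h)
        omega
      exact exists_torsion_goodReductionHom_ne_zero_of_residue_c₄_eq_zero
        (O := (specVal v).valuationSubring) (Valuation.integer.integers (specVal v)) hΔ p hp5
        (dvd_trans h3e hedvd)
        (residue_c₄_eq_zero_of_goodModel W p hpv hW₀ hΔ
          (j_eq_zero_or_padicValRat_j_pos_of_not_three_dvd W p hj h3v))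
    · have h4e : 4 ∣ semistabilityIndex W p := by
        rcases hecase with h | h | h | h <;> rw [h] at h3e ⊢ <;> omega
      have h2v : ¬ 2 ∣ padicValInt p W.minimalDiscriminantInt := by
        intro h
        have : 4 ∣ 6 := dvd_trans h4e (semistabilityIndex_dvd_six_of_two_dvd W p h)
        omega
      exact exists_torsion_goodReductionHom_ne_zero_of_residue_c₆_eq_zero
        (O := (specVal v).valuationSubring) (Valuation.integer.integers (specVal v)) hΔ p hp5
        (dvd_trans h4e hedvd)
        (residue_c₆_eq_zero_of_goodModel W p hpv hW₀ hΔ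
          (j_eq_or_padicValRat_j_sub_pos_of_not_two_dvd W p hp5 hj h2v))
  -- the prime-to-`p` normal fixing level of `θ`
  have hdeg : (minpoly ℚ θ).natDegree ≤ semistabilityIndex W p := by
    have hne : (Polynomial.X ^ semistabilityIndex W p - Polynomial.C ((p : ℕ) : ℚ) : ℚ[X]) ≠ 0 :=
      Polynomial.X_pow_sub_C_ne_zero (Nat.pos_of_ne_zero (semistabilityIndex_ne_zero p W)) _
    have hdvd : minpoly ℚ θ ∣ Polynomial.X ^ semistabilityIndex W p - Polynomial.C ((p : ℕ) : ℚ) :=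
      minpoly.dvd ℚ θ (by
        rw [map_sub, map_pow, Polynomial.aeval_X, Polynomial.aeval_C, map_natCast, hθ, sub_self])
    exact (Polynomial.natDegree_le_of_dvd hdvd hne).trans (Polynomial.natDegree_X_pow_sub_C).le
  obtain ⟨U, hUn, hUo, hcop, hUθ⟩ := exists_normal_isOpen_coprime_smul_eq ℚ hp.out θ hdeg helt
  refine ⟨hbad, C, W₀, hW₀, hΔ, hord, U, hUn, hUo, hcop, fun σ hσ ↦ hfixC σ ?_⟩
  exact smul_absClosureEmbedding_eq_of_absGaloisRestrict_mem ℚ (v.adicCompletion ℚ) hUθ σ hσ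

variable {W p}

/-! ## §2 Class forms WITHOUT the defect binder -/

/-- **X4♯(G-ord), EVERY semistability defect, `p ≥ 5`: cc-typer-2's typed δ-input
`RamifiedLineKummerEqAt W p` HOLDS mod S2 ONLY** — F8's `ClassX4Gord.ramifiedLineKummerEqAt (hGrK)
(hX) (he : e = 2)` WITHOUT `he`: `e = 2` ↦ F8 with A239 := S2-derived
(`imKummer_ge_strictCondition_goodOrdinary_of_goodOrdinaryModel`), `e ∈ {3, 4, 6}` ↦ §1.
X4♯(G-ord) stays CONSTRUCTION-SHAPED; nothing booked.
[cite: GreenbergLNM1716, §2 Props. 2.2, 2.4 (pp. 73–75) and §5 p. 143] [cite: GreenbergVatsal2000, §2 p. 26] -/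
theorem ClassX4Gord.ramifiedLineKummerEqAt_of_five_le
    (hS2 : imKummer_ge_strictCondition_goodOrdinaryModel) (hX : ClassX4Gord W p) (hp5 : 5 ≤ p) :
    RamifiedLineKummerEqAt W p := by
  by_cases he : semistabilityIndex W p = 2
  · exact hX.ramifiedLineKummerEqAt (imKummer_ge_strictCondition_goodOrdinary_of_goodOrdinaryModel hS2) he
  · exact ramifiedLineKummerEqAt_of_typeGOrd_of_semistabilityIndex_ne_two W p hS2 hp5 hX.typeGOrd
      hX.addv.2 he

/-- **X3♯(G-ord), EVERY semistability defect, `p ≥ 5`: `RamifiedLineKummerEqAt W p` mod S2 ONLY**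
(`e = 2` ↦ F8 `ClassX3Gord.ramifiedLineKummerEqAt` with A239 := S2-derived; `e ≠ 2` ↦ §1). X3♯(G-ord)
stays as labelled; nothing booked. [cite: GreenbergLNM1716, §2 Props. 2.2, 2.4 (pp. 73–75) and §5 p. 143]
[cite: GreenbergVatsal2000, §2 p. 26] -/
theorem ClassX3Gord.ramifiedLineKummerEqAt_of_five_le
    (hS2 : imKummer_ge_strictCondition_goodOrdinaryModel) (hX : ClassX3Gord W p) (hp5 : 5 ≤ p) :
    RamifiedLineKummerEqAt W p := by
  have hp2 : p ≠ 2 := by omega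
  by_cases he : semistabilityIndex W p = 2
  · exact hX.ramifiedLineKummerEqAt (imKummer_ge_strictCondition_goodOrdinary_of_goodOrdinaryModel hS2)
      hp2 he
  · exact ramifiedLineKummerEqAt_of_typeGOrd_of_semistabilityIndex_ne_two W p hS2 hp5 hX.typeGOrd
      hX.addv he

/-- **X4♯(G-ord) at EVERY odd prime, NO defect binder: the δ-input `RamifiedLineKummerEqAt W p` mod
S2 ONLY.** At `p = 3`, (G) forces `e_E(3) = 2` (additive-p2's `semistabilityIndex_eq_two_of_typeG_three`),
so F8 applies; at `p ≥ 5`, `ClassX4Gord.ramifiedLineKummerEqAt_of_five_le`. This is the `hRD` binder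
of the GV transfer records on ALL of X4♯(G-ord) (`p` odd is part of `ClassX4`), conditional on the one
published input S2. X4♯(G-ord) stays CONSTRUCTION-SHAPED; nothing booked.
[cite: GreenbergLNM1716, §2 Props. 2.2, 2.4 (pp. 73–75) and §5 p. 143] [cite: GreenbergVatsal2000, §2 p. 26]
[cite: CoatesLNM1716, p. 31 (62)] -/
theorem ClassX4Gord.ramifiedLineKummerEqAt' (hS2 : imKummer_ge_strictCondition_goodOrdinaryModel)
    (hX : ClassX4Gord W p) : RamifiedLineKummerEqAt W p := by
  have hp2 : p ≠ 2 := hX.addv.1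
  by_cases hp3 : p = 3
  · subst hp3
    exact hX.ramifiedLineKummerEqAt (imKummer_ge_strictCondition_goodOrdinary_of_goodOrdinaryModel hS2)
      (semistabilityIndex_eq_two_of_typeG_three W hX.typeGOrd.typeG hX.addv.2)
  · have hp5 : 5 ≤ p := by
      have h2 := hp.out.two_le
      rcases Nat.lt_or_ge p 5 with h | h
      · interval_cases p
        · exact absurd rfl hp2
        · exact absurd rfl hp3
        · exact absurd hp.out (by decide)
      · exact h
    exact ClassX4Gord.ramifiedLineKummerEqAt_of_five_le hS2 hX hp5

/-- **X3♯(G-ord) at EVERY odd prime, NO defect binder: `RamifiedLineKummerEqAt W p` mod S2 ONLY**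
(`p = 3`: `e = 2` forced, F8; `p ≥ 5`: `ClassX3Gord.ramifiedLineKummerEqAt_of_five_le`). X3♯(G-ord)
stays as labelled; nothing booked. [cite: GreenbergLNM1716, §2 Props. 2.2, 2.4 (pp. 73–75) and §5 p. 143]
[cite: GreenbergVatsal2000, §2 p. 26] [cite: CoatesLNM1716, p. 31 (62)] -/
theorem ClassX3Gord.ramifiedLineKummerEqAt' (hS2 : imKummer_ge_strictCondition_goodOrdinaryModel)
    (hp2 : p ≠ 2) (hX : ClassX3Gord W p) : RamifiedLineKummerEqAt W p := by
  by_cases hp3 : p = 3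
  · subst hp3
    exact hX.ramifiedLineKummerEqAt (imKummer_ge_strictCondition_goodOrdinary_of_goodOrdinaryModel hS2)
      hp2 (semistabilityIndex_eq_two_of_typeG_three W hX.typeGOrd.typeG hX.addv)
  · have hp5 : 5 ≤ p := by
      have h2 := hp.out.two_le
      rcases Nat.lt_or_ge p 5 with h | h
      · interval_cases p
        · exact absurd rfl hp2
        · exact absurd rfl hp3
        · exact absurd hp.out (by decide)
      · exact h
    exact ClassX3Gord.ramifiedLineKummerEqAt_of_five_le hS2 hX hp5

end Summit.BirchSwinnertonDyer.Rank1Residual.Additive.GoodModelLine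

end
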